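import Literature.AlgebraicGeometry.Resolution.MonoidalSupportReduction
import HarnessLib

/-!
# [CoP1] Prop. 8.1, the reduction `♯E = ♯F ≤ r`, with the rational-rank relations asked ONLY for
# parameters dividing `f` inside a subring `C`

Topic: `Literature/AlgebraicGeometry/Resolution` (proofs only; no new notions, no new named
facts). `MonoidalSupportReduction.lean` proves the loop `♯E = ♯F ≤ r` of [CoP1] Prop. 8.1
(V. Cossart, O. Piltant, J. Algebra 320 (2008), HAL hal-00139124, p. 23: "Suppose that
`♯(E) > r` … By lemma 8.2 below … Therefore we can achieve a reduction of `♯(E)` if `♯(E) > r`")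
from a supplier `hdep` of a non-trivial multiplicative relation among the values of EVERY family of
more than `r` nonzero elements — i.e. "the rational rank of the valuation is at most `r`". In
Cossart–Piltant 2019's descent from the formal completion (J. Algebra 529 (2019) = arXiv:1412.0868,
proof of Prop. 4.8 with Lemma 4.7, arXiv v1 Prop. 4.6 p. 53) the loop runs along the EXTENSION
`v̂` of the rank-one valuation `v` (rational rank `r`) to a formal branch `K̂₁`, and the rational
rank of `v̂` is in general LARGER than `r` (the values of `y − φ(x) ∈ Â` along a transcendental
formal arc are infinitely large with respect to `Γ_v`): the printed loop only ever uses the relation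
for the CURRENT PARAMETERS DIVIDING `h ∈ A`, whose values are bounded by `v(h)` and therefore lie
in `Γ_v` ("it is not necessary to assume here that `dim 𝒪_v̂ = 1` because `h ∈ A`").

This file re-proves the loop with `hdep` asked only for families `y` whose members indexed in `I`
lie in `locAtCentre C O` for a subring `C ⊇ R₀ ∋ f⁻¹` and divide `f` in valuation
(`O.valuation f ≤ O.valuation (y k)`), which is exactly what the proof applies it to (the regular
parameters `x_k`, `k ∈ E = supp α`, of the current tracked model `R_t ⊆ locAtCentre C O`,
`f = u ∏ x^α`):

* `exists_frameStepsTracked_card_supp_le_subset_within` — `exists_frameStepsTracked_card_supp_le_subset`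
  with the restricted `hdep`; proof verbatim around the one call to `hdep`.

## Sources

* V. Cossart, O. Piltant, J. Algebra 320 (2008) 1051–1082: proof of Prop. 8.1 and Lemma 8.2
  (HAL hal-00139124, pp. 22–23). [CossartPiltant2008]
* V. Cossart, O. Piltant, J. Algebra 529 (2019) 268–535 = arXiv:1412.0868, proof of Prop. 4.8
  with Lemma 4.7 (arXiv v1: Prop. 4.6, p. 53). [CossartPiltant2019]
-/

noncomputable section

namespace Literature.AlgebraicGeometry.Resolution

universe u

open IsLocalRing _root_.Polynomial Function

section SupportReductionWithin

variable {S : Type u} [CommRing S] [IsDomain S] [IsLocalRing S] {E : Type u} [Field E]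
  [Algebra S E] [Algebra.IsAlgebraic S E]
  (hSuc : IsUniversallyCatenaryRing S) (hinj : Function.Injective (algebraMap S E))
  (O : ValuationSubring E) (hSO : ∀ s : S, algebraMap S E s ∈ O)
  (hdom : ∀ s ∈ maximalIdeal S, O.valuation (algebraMap S E s) < 1)
  (hres : ∀ y : O, ∃ q : S[X], (∃ i, q.coeff i ∉ maximalIdeal S) ∧
    O.valuation (q.eval₂ (algebraMap S E) y) < 1)
  {d : ℕ} (hSdim : ringKrullDim S = d)
  (R₀ : Subring E) (hSR₀ : ∀ s : S, algebraMap S E s ∈ R₀)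

omit [IsDomain S] [IsLocalRing S] [Algebra.IsAlgebraic S E] in
/-- `v(f) ≤ v(x_i)` for a monomial `f = u ∏ x_c^{α_c}` with `u, x_c ∈ R ⊆ O` and `α_i > 0`
(a factor of an element of `O` has larger value). [folklore] -/
private theorem valuation_le_of_monomial' {R : Subring E} (hRO : R ≤ O.toSubring) {f u : E}
    (huR : u ∈ R) (x : Fin d → R) (α : Fin d → ℕ) (hf : f = u * ∏ c, (x c : E) ^ α c)
    (i : Fin d) (hαi : 0 < α i) : O.valuation f ≤ O.valuation (x i : E) := by
  classical
  set r : E := u * (x i : E) ^ (α i - 1) * ∏ c ∈ Finset.univ.erase i, (x c : E) ^ α c with hrdef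
  have hprod : (∏ c, (x c : E) ^ α c) =
      (x i : E) ^ α i * ∏ c ∈ Finset.univ.erase i, (x c : E) ^ α c :=
    (Finset.mul_prod_erase Finset.univ (fun c => (x c : E) ^ α c) (Finset.mem_univ i)).symm
  have hpow : (x i : E) ^ α i = (x i : E) ^ (α i - 1) * (x i : E) := by
    rw [← pow_succ, Nat.sub_add_cancel hαi]
  have hr : f = (x i : E) * r := by
    rw [hf, hprod, hpow, hrdef]; ring
  have hrR : r ∈ R :=
    Subring.mul_mem _ (Subring.mul_mem _ huR (Subring.pow_mem _ (x i).2 _))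
      (prod_mem fun c _ => Subring.pow_mem _ (x c).2 _)
  have hr1 : O.valuation r ≤ 1 := (O.valuation_le_one_iff _).mpr (hRO hrR)
  rw [hr, map_mul]
  exact mul_le_of_le_one_right' hr1

omit [IsDomain S] [IsLocalRing S] [Algebra.IsAlgebraic S E] in
include hSR₀ in
/-- A tracked generating set (`fⁿ t ⊆ R₀`) lies in any subring `C ⊇ R₀ ∋ f⁻¹`, hence so does
`S[t]`. [folklore] -/
private theorem adjoin_le_of_tracked' (C : Subring E) (hR₀C : R₀ ≤ C) {f : E} (hfC : f⁻¹ ∈ C)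
    (hf0 : f ≠ 0) (t : Set E) (hTR : ∀ y ∈ t, ∃ n : ℕ, f ^ n * y ∈ R₀) :
    (Algebra.adjoin S t).toSubring ≤ C := by
  let C' : Subalgebra S E := { C with algebraMap_mem' := fun s => hR₀C (hSR₀ s) }
  have h : Algebra.adjoin S t ≤ C' := by
    rw [Algebra.adjoin_le_iff]
    intro y hy
    obtain ⟨n, hn⟩ := hTR y hy
    have : y = (f⁻¹) ^ n * (f ^ n * y) := by
      rw [← mul_assoc, ← mul_pow, inv_mul_cancel₀ hf0, one_pow, one_mul]
    change y ∈ C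
    rw [this]
    exact Subring.mul_mem _ (Subring.pow_mem _ hfC _) (hR₀C hn)
  intro y hy
  exact h hy

set_option maxHeartbeats 1600000 in
include hSuc hinj hSO hdom hres hSdim hSR₀ in
/-- **[CoP1] Prop. 8.1, the reduction `♯E = ♯F ≤ r`, tracked and confined, with the
rational-rank relations asked only for parameters dividing `f` inside `C`.** As
`exists_frameStepsTracked_card_supp_le_subset` (from a tracked state `fⁿ t ⊆ R₀`, `t ⊆ F`,
`f = u ∏ x^α`, `h = w ∏ x^β`, `supp α = supp β`, finitely many monoidal transforms along `O` —
Lemma 8.2, then the unit step at the two parameters of equal value — reach such a state with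
`♯ supp α′ ≤ r`), but the supplier `hdep` of a non-trivial relation
`∏ v(y_k)^{c_k⁺} = ∏ v(y_k)^{c_k⁻}` (`c ≠ 0` supported on `I`, `♯I > r`) is asked only for
families `y` with `y_k ∈ locAtCentre C O` and `v(f) ≤ v(y_k)` for `k ∈ I`, where `C` is a
subring with `R₀ ⊆ C ∋ f⁻¹`. The proof applies `hdep` to the regular parameters `x_k`,
`k ∈ supp α`, of the current model `R_t`: `R_t ⊆ locAtCentre C O` because `fⁿ t ⊆ R₀`, and
`x_k ∣ f`. (In Cossart–Piltant 2019's descent the values of such `y_k` are bounded by `v(h)`,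
hence lie in the value group of the rank-one valuation downstairs, of rational rank `r`, while
the extension `v̂` may have larger rational rank.)
[cite: CossartPiltant2008, proof of Prop. 8.1 (HAL p. 23)]
[cite: CossartPiltant2019, proof of Prop. 4.8 with Lemma 4.7 (arXiv v1: Prop. 4.6, p. 53)] -/
theorem exists_frameStepsTracked_card_supp_le_subset_within (f : E) (hfR₀ : f ∈ R₀)
    (F : Subfield E) (hSF : ∀ s : S, algebraMap S E s ∈ F)
    (C : Subring E) (hR₀C : R₀ ≤ C) (hfC : f⁻¹ ∈ C) (r : ℕ)
    (hdep : ∀ (I : Finset (Fin d)) (y : Fin d → E), r < I.card → (∀ k, y k ≠ 0) →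
      (∀ k ∈ I, y k ∈ locAtCentre C O ∧ O.valuation f ≤ O.valuation (y k)) →
      ∃ c : Fin d → ℤ, (∀ k, k ∉ I → c k = 0) ∧ c ≠ 0 ∧
        ∏ k, O.valuation (y k) ^ (c k).toNat = ∏ k, O.valuation (y k) ^ (-c k).toNat)
    (n : ℕ) :
    ∀ (t : Set E) (_ : t.Finite) (_ : t ⊆ F) (_ : ∀ y ∈ t, ∃ n : ℕ, f ^ n * y ∈ R₀)
      (hTO : (Algebra.adjoin S t).toSubring ≤ O.toSubring)
      (_ : IsRegularLocalRing (locAtCentre (Algebra.adjoin S t).toSubring O))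
      (x : Fin d → locAtCentre (Algebra.adjoin S t).toSubring O)
      (_ : haveI := isLocalRing_locAtCentre hTO
        Ideal.span (Set.range x) = maximalIdeal _)
      (h u w : E) (_ : u ∈ locAtCentre (Algebra.adjoin S t).toSubring O)
      (_ : O.valuation u = 1) (_ : w ∈ locAtCentre (Algebra.adjoin S t).toSubring O)
      (_ : O.valuation w = 1) (α β : Fin d → ℕ)
      (_ : f = u * ∏ c, (x c : E) ^ α c) (_ : h = w * ∏ c, (x c : E) ^ β c)
      (_ : ∀ c, 0 < α c ↔ 0 < β c)
      (_ : (Finset.univ.filter (fun c => 0 < α c)).card ≤ r + n),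
    ∃ (t' : Set E), t ⊆ t' ∧ t'.Finite ∧ t' ⊆ F ∧ (∀ y ∈ t', ∃ n : ℕ, f ^ n * y ∈ R₀) ∧
      ∃ (hT'O : (Algebra.adjoin S t').toSubring ≤ O.toSubring),
        IsRegularLocalRing (locAtCentre (Algebra.adjoin S t').toSubring O) ∧
        locAtCentre (Algebra.adjoin S t).toSubring O ≤
          locAtCentre (Algebra.adjoin S t').toSubring O ∧
        ∃ (x' : Fin d → locAtCentre (Algebra.adjoin S t').toSubring O) (u' w' : E)
          (α' β' : Fin d → ℕ),
          (haveI := isLocalRing_locAtCentre hT'O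
           Ideal.span (Set.range x') = maximalIdeal _) ∧
          u' ∈ locAtCentre (Algebra.adjoin S t').toSubring O ∧ O.valuation u' = 1 ∧
          w' ∈ locAtCentre (Algebra.adjoin S t').toSubring O ∧ O.valuation w' = 1 ∧
          f = u' * ∏ c, (x' c : E) ^ α' c ∧ h = w' * ∏ c, (x' c : E) ^ β' c ∧
          (∀ c, 0 < α' c ↔ 0 < β' c) ∧
          (Finset.univ.filter (fun c => 0 < α' c)).card ≤ r := by
  classical
  induction n with
  | zero =>
    intro t ht htF hTR hTO hreg x hx h u w huR hvu hwR hvw α β hf hh hEF hcard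
    exact ⟨t, le_rfl, ht, htF, hTR, hTO, hreg, le_rfl, x, u, w, α, β, hx, huR, hvu, hwR, hvw, hf,
      hh, hEF, hcard⟩
  | succ k ih =>
    intro t ht htF hTR hTO hreg x hx h u w huR hvu hwR hvw α β hf hh hEF hcard
    by_cases hle : (Finset.univ.filter (fun c => 0 < α c)).card ≤ r + k
    · exact ih t ht htF hTR hTO hreg x hx h u w huR hvu hwR hvw α β hf hh hEF hle
    -- `♯E > r`: a relation among the values of the `x_k`, `k ∈ E`
    set I : Finset (Fin d) := Finset.univ.filter (fun c => 0 < α c) with hIdef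
    have hIcard : r < I.card := by omega
    have hIα : ∀ k ∈ I, 0 < α k := fun k hk => (Finset.mem_filter.mp hk).2
    have hx0 : ∀ k, (x k : E) ≠ 0 := fun k =>
      coe_rsop_ne_zero_of_frame hSuc hinj O hSO hdom hres hSdim t ht hTO hreg x hx k
    -- the parameters `x_k`, `k ∈ E`, lie in `locAtCentre C O` and divide `f`
    have hf0 : f ≠ 0 := by
      rw [hf]
      exact mul_ne_zero (ne_zero_of_valuation_eq_one hvu)
        (Finset.prod_ne_zero_iff.mpr fun c _ => pow_ne_zero _ (hx0 c))
    have hRC : locAtCentre (Algebra.adjoin S t).toSubring O ≤ locAtCentre C O :=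
      locAtCentre_mono O (adjoin_le_of_tracked' R₀ hSR₀ C hR₀C hfC hf0 t hTR)
    have hIC : ∀ k ∈ I, (x k : E) ∈ locAtCentre C O ∧ O.valuation f ≤ O.valuation (x k : E) :=
      fun k hk => ⟨hRC (x k).2,
        valuation_le_of_monomial' O (locAtCentre_le hTO) huR x α hf k (hIα k hk)⟩
    obtain ⟨c, hcI, hc0, hrel⟩ := hdep I (fun k => (x k : E)) hIcard hx0 hIC
    -- Lemma 8.2: reach two parameters of equal value
    obtain ⟨t₁, htt₁, ht₁, ht₁F, hTR₁, hT₁O, hreg₁, hsub₁, x₁, hspan₁, hx₁off,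
      ⟨T, hTmono, hTle, hToff⟩, i, hiI, i', hi'I, hii', hvii'⟩ :=
      exists_frameStepsTracked_valuation_eq_subset hSuc hinj O hSO hdom hres hSdim R₀ hSR₀ f hfR₀ F
        hSF I _ t ht htF hTR hTO hreg x hx u huR α hIα hf (fun k => (c k).toNat)
        (fun k => (-c k).toNat) c (fun k => (Int.toNat_sub_toNat_neg (c k)).symm) hcI hc0 hrel rfl
    -- supports are unchanged by the Perron moves
    have hTα : ∀ k, 0 < T α k ↔ 0 < α k := fun k => by
      refine ⟨fun hk => ?_, fun hk => lt_of_lt_of_le hk (hTle α k)⟩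
      by_cases hkI : k ∈ I
      · exact hIα k hkI
      · rw [hToff α k hkI] at hk; exact hk
    have hTβ : ∀ k, 0 < T β k ↔ 0 < β k := fun k => by
      refine ⟨fun hk => ?_, fun hk => lt_of_lt_of_le hk (hTle β k)⟩
      by_cases hkI : k ∈ I
      · exact (hEF k).mp (hIα k hkI)
      · rw [hToff β k hkI] at hk; exact hk
    have hf₁ : f = u * ∏ c, (x₁ c : E) ^ T α c := by rw [hf, hTmono α]
    have hh₁ : h = w * ∏ c, (x₁ c : E) ^ T β c := by rw [hh, hTmono β]
    -- the unit step at `(x_i, x_{i'})`: `z = x_{i'} / x_i` has value `0`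
    have hx₁0 : ∀ k, (x₁ k : E) ≠ 0 := fun k =>
      coe_rsop_ne_zero_of_frame hSuc hinj O hSO hdom hres hSdim t₁ ht₁ hT₁O hreg₁ x₁ hspan₁ k
    have h1 : O.valuation ((x₁ i' : E) / (x₁ i : E)) = 1 := by
      rw [map_div₀, ← hvii', div_self]
      exact fun h0 => hx₁0 i ((Valuation.zero_iff _).mp h0)
    have hzf : (x₁ i' : E) / (x₁ i : E) * f ∈ locAtCentre (Algebra.adjoin S t₁).toSubring O :=
      div_mul_monomial_mem_locAtCentre O t₁ x₁ f u (hsub₁ huR) (T α) hf₁ i i'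
        ((hTα i).mpr (hIα i hiI)) (hx₁0 i)
    set z : E := (x₁ i' : E) / (x₁ i : E) with hzdef
    obtain ⟨t₂, ht₁t₂, ht₂, ht₂F, hTR₂, hT₂O, hreg₂, hzR, x₂, hx₂c, hspan₂, hmono₂⟩ :=
      exists_frameStepTracked_of_valuation_eq_one_subset hSuc hinj O hSO hdom hres hSdim R₀ hSR₀ f
        hfR₀ F hSF t₁ ht₁ ht₁F hTR₁ hT₁O hreg₁ x₁ hspan₁ i i' hii' h1 hzf
    have hsub₂ : locAtCentre (Algebra.adjoin S t₁).toSubring O ≤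
        locAtCentre (Algebra.adjoin S t₂).toSubring O :=
      locAtCentre_mono O (fun y hy => Algebra.adjoin_mono ht₁t₂ hy)
    -- the new exponents: `i'` leaves `E` and `F`
    set α₂ : Fin d → ℕ := update (update (T α) i (T α i + T α i')) i' 0 with hα₂def
    set β₂ : Fin d → ℕ := update (update (T β) i (T β i + T β i')) i' 0 with hβ₂def
    have hsuppα₂ : ∀ k, 0 < α₂ k ↔ (k ≠ i' ∧ 0 < α k) := fun k => by
      by_cases hk' : k = i'
      · subst hk'; simp only [hα₂def, update_self, lt_self_iff_false, ne_eq, not_true_eq_false,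
          false_and]
      · rw [hα₂def, update_of_ne hk']
        by_cases hk : k = i
        · subst hk
          rw [update_self]
          exact ⟨fun _ => ⟨hk', hIα k hiI⟩,
            fun _ => Nat.add_pos_left ((hTα k).mpr (hIα k hiI)) _⟩
        · rw [update_of_ne hk, hTα k]
          exact ⟨fun hp => ⟨hk', hp⟩, fun hp => hp.2⟩
    have hsuppβ₂ : ∀ k, 0 < β₂ k ↔ (k ≠ i' ∧ 0 < β k) := fun k => by
      by_cases hk' : k = i'
      · subst hk'; simp only [hβ₂def, update_self, lt_self_iff_false, ne_eq, not_true_eq_false,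
          false_and]
      · rw [hβ₂def, update_of_ne hk']
        by_cases hk : k = i
        · subst hk
          rw [update_self]
          exact ⟨fun _ => ⟨hk', (hEF k).mp (hIα k hiI)⟩,
            fun _ => Nat.add_pos_left ((hTβ k).mpr ((hEF k).mp (hIα k hiI))) _⟩
        · rw [update_of_ne hk, hTβ k]
          exact ⟨fun hp => ⟨hk', hp⟩, fun hp => hp.2⟩
    have hEF₂ : ∀ k, 0 < α₂ k ↔ 0 < β₂ k := fun k => by
      rw [hsuppα₂, hsuppβ₂, hEF k]
    have hcard₂ : (Finset.univ.filter (fun c => 0 < α₂ c)).card ≤ r + k := by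
      have hEq : Finset.univ.filter (fun c => 0 < α₂ c) = I.erase i' := by
        ext c
        simp only [Finset.mem_filter, Finset.mem_univ, true_and, Finset.mem_erase, hIdef,
          hsuppα₂]
      rw [hEq, Finset.card_erase_of_mem hi'I]
      omega
    obtain ⟨t₃, ht₂t₃, ht₃, ht₃F, hTR₃, hT₃O, hreg₃, hsub₃, x₃, u₃, w₃, α₃, β₃, hspan₃, hu₃R, hvu₃,
      hw₃R, hvw₃, hf₃, hh₃, hEF₃, hcard₃⟩ :=
      ih t₂ ht₂ ht₂F hTR₂ hT₂O hreg₂ x₂ hspan₂ h (u * z ^ T α i') (w * z ^ T β i')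
        (Subring.mul_mem _ (hsub₂ (hsub₁ huR)) (Subring.pow_mem _ hzR _))
        (by rw [map_mul, map_pow, hvu, h1, one_pow, one_mul])
        (Subring.mul_mem _ (hsub₂ (hsub₁ hwR)) (Subring.pow_mem _ hzR _))
        (by rw [map_mul, map_pow, hvw, h1, one_pow, one_mul]) α₂ β₂
        (by rw [hf₁, hmono₂ (T α), mul_assoc]) (by rw [hh₁, hmono₂ (T β), mul_assoc]) hEF₂ hcard₂
    exact ⟨t₃, htt₁.trans (ht₁t₂.trans ht₂t₃), ht₃, ht₃F, hTR₃, hT₃O, hreg₃,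
      hsub₁.trans (hsub₂.trans hsub₃), x₃, u₃, w₃, α₃, β₃, hspan₃, hu₃R, hvu₃, hw₃R, hvw₃, hf₃, hh₃,
      hEF₃, hcard₃⟩

end SupportReductionWithin

end Literature.AlgebraicGeometry.Resolution

end
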